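import Summits.QuantumFields.BalabanUV.Beta.FP.CoarseJetUnit
import Summits.QuantumFields.BalabanUV.Beta.FP.ColourDoublingKkt

/-!
# `BalabanUV.Beta.FP.CoarseJetUnitGraded` — road «FP» for binder row D1, ROUTE T, option (δ) «LIFT ∕ GRADED» (R-FP-54′): **THE GRADED LEVEL-UP KIT** —
# the unit drops out of a bordered 2-jet ALSO when the odd jet is (−)-placed (`fromBlocks (c•H₁) (−Q₁ᵀ) Q₁ 0`), and the torus call's coarse term
# READS ONE LEVEL UP in the graded door's shape (OWNER d1-p3 g19's WANTED W-FP-19-5; the graded twin of `FP/CoarseJetUnit` §2–§4, leaf-05 g26 p317669)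

WHAT.  Under R-FP-54′ the (STEP) door `NestedStepLawOneShotJetsGraded.secondVar_oneShot_nestedStepLaw_jets_graded` (p323821) concludes a three-term
law whose ODD bordered jets are (−)-PLACED — `fromBlocks K₁ (−C₁ᵀ) C₁ 0 = kkt K₁ C₁ · diag(1, −1)` (`ColourDoublingKkt.kkt_signTwist`) — instead of
`kkt K₁ C₁`.  The level-up step of the torus call (`CoarseJetUnit.torus_coarse_secondVar_of_hId`: the coarse term's form blocks are
`(wVH d Lc (j+1))⁻¹ •` the level-`(j+1)` objects, and a non-zero scalar on the form block drops out of `secondVar`) must therefore be re-typed for the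
(−)-placed middle jet.  This file does exactly that and nothing else:
* §1 `signTwist_smul_form_eq_conj (hc : c ≠ 0) : fromBlocks (c•H) (−Qᵀ) Q 0 = diag(c•1, 1) · fromBlocks H (−Qᵀ) Q 0 · diag(1, c⁻¹•1)` — the
  (−)-placed twin of `CoarseJetUnit.kkt_smul_form_eq_conj` (the sign twist commutes with the static right factor);
* §2 `secondVar_kkt_smul_form_graded (hc) : secondVar (kkt (c•H₀) Q₀) (fromBlocks (c•H₁) (−Q₁ᵀ) Q₁ 0) (kkt (c•H₂) Q₂)
  = secondVar (kkt H₀ Q₀) (fromBlocks H₁ (−Q₁ᵀ) Q₁ 0) (kkt H₂ Q₂)` — ANY blocks, no symmetry ∕ invertibility of `Hₙ` asked;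
* §3 `secondVar_coarse_of_hId_graded` — under `hIdₙ : Eₙ = c • H′ₙ` the graded coarse 2-jet reads at `H′ₙ`;
* §4 `torus_coarse_secondVar_of_hId_graded` — at the record's index types, with EXACTLY the binders of `CoarseJetUnit.torus_coarse_secondVar_of_hId`
  (order 0 by `RelInvPeriodisedEffFormCoarse.hId_order_zero_record`, orders 1–2 DISPLAYED `hId₁ hId₂`), the middle jets (−)-placed.
Nothing of the dictionary is asserted: `hId₁ hId₂` stay displayed hypotheses, as in p317669.

HONEST DEPENDENCY (page 1, mandatory): continuum YM on T⁴ ⇐ BetaPertH ∧ nine spine estimates (0/9 proved); BetaPertH ⇐ (D1) ∧ (D4) ∧ CAP+tail;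
G-an2-4 gates asym, D1 and NE2/3/4.  HONEST FRAMING (cell contract, verbatim): «discharging `BetaPertH` makes Bałaban's UV stability UNCONDITIONAL —
a real constructive-QFT result; it is NOT the continuum limit and NOT the Clay problem.»  ABSOLUTE RULE (cell charter, verbatim): «No internally-minted
statement may enter as a cited fact. Every hypothesis is either kernel-proved in this package or a verbatim quotation of a PUBLISHED theorem with page
reference. The manuscript(s) under audit are NOT citable for their own disputed steps — they are the thing under adjudication; programme-internal
(2001/route/tribunal) claims are never citable.»  [folklore] static conjugation algebra over OUR typed objects BY NAME; no `def`, no `def … : Prop`,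
nothing cited, 0 sorry; 0 estimates; 0∕4 row-D1 binders; NOT (T-ID), NOT SDF, NOT D1, NOT BetaPertH, NOT continuum, NOT Clay.  D1 formalisation
swarm LEAF PROVER 05 (b2b-balaban-beta-d1-formalise-leaf-05 gen 28), 2026-08-22.  No existing file touched.
-/

noncomputable section

open scoped BigOperators Matrix

namespace Summit.QuantumFields.BalabanUV.Beta.FP.CoarseJetUnitGraded

open Matrix
open Literature.Probability.LatticeModels (Torus.proj)
open Literature.MathematicalPhysics.QuantumFieldTheory.Balaban1983to89
open Literature.MathematicalPhysics.QuantumFieldTheory.Balaban1983to89.Beta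
open Literature.MathematicalPhysics.QuantumFieldTheory.Balaban1983to89.Beta.Composition (kkt)
open Literature.MathematicalPhysics.QuantumFieldTheory.Balaban1983to89.Beta.CompositionSingular (effForm)
open B5Prop11Plancherel (fine)
open B6Lemma24Torus (pbox)
open AffineAveraging (Site box toSite)
open OneStepResolventKernel (Fib)
open BalabanStepJetsSucc (wVH)
open Summit.QuantumFields.BalabanUV.Beta.BorderedHessian (bhKStepAt)
open Summit.QuantumFields.BalabanUV.Beta.D1BFx.LogDetSecondVariation (secondVar)
open Summit.QuantumFields.BalabanUV.Beta.FP.KernelPeriodisationFib (Idx perF)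
open Summit.QuantumFields.BalabanUV.Beta.FP.TorusCombRows (Res combRowsT)
open Summit.QuantumFields.BalabanUV.Beta.FP.RelInvPeriodisedEffFormCoarse (hId_order_zero_record wVH_pos)
open Summit.QuantumFields.BalabanUV.Beta.FP.NestedStepLawOneShotLetters (secondVar_mul_right)
open Summit.QuantumFields.BalabanUV.Beta.FP.CoarseJetUnit (kkt_smul_form_eq_conj secondVar_mul_left)

/-! ## §1 Scaling the form block of a (−)-placed bordered jet is the same static conjugation -/

section Generic

variable {ι ν κ μ ρ₂ : Type*} [Fintype ι] [Fintype ν] [Fintype κ] [Fintype μ] [Fintype ρ₂]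
  [DecidableEq ι] [DecidableEq ν] [DecidableEq κ] [DecidableEq μ] [DecidableEq ρ₂]

omit [Fintype ι] [Fintype μ] [Fintype ρ₂] [DecidableEq ι] [DecidableEq μ] [DecidableEq ρ₂] in
/-- [folklore] **SCALING THE FORM BLOCK OF THE (−)-PLACED BORDERED JET IS A STATIC CONJUGATION**: for `c ≠ 0`,
`[[c•H, −Qᵀ],[Q, 0]] = diag(c•1, 1) · [[H, −Qᵀ],[Q, 0]] · diag(1, c⁻¹•1)` — the (−)-placed twin of `CoarseJetUnit.kkt_smul_form_eq_conj`
(the sign twist `diag(1, −1)` of `ColourDoublingKkt.kkt_signTwist` commutes with the right factor). -/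
theorem signTwist_smul_form_eq_conj {c : ℝ} (hc : c ≠ 0) (H : Matrix ν ν ℝ) (Q : Matrix κ ν ℝ) :
    fromBlocks (c • H) (-Qᵀ) Q 0
      = fromBlocks (c • (1 : Matrix ν ν ℝ)) 0 0 (1 : Matrix κ κ ℝ) * fromBlocks H (-Qᵀ) Q 0
          * fromBlocks (1 : Matrix ν ν ℝ) 0 0 (c⁻¹ • (1 : Matrix κ κ ℝ)) := by
  rw [fromBlocks_multiply, fromBlocks_multiply]
  simp only [Matrix.mul_zero, Matrix.zero_mul, add_zero, zero_add, Matrix.one_mul, Matrix.mul_one, Matrix.smul_mul, Matrix.mul_smul,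
    Matrix.mul_neg, smul_neg, neg_zero, smul_zero, smul_smul, inv_mul_cancel₀ hc, one_smul]

/-! ## §2 The unit drops out of a GRADED bordered 2-jet -/

omit [Fintype ι] [Fintype μ] [Fintype ρ₂] [DecidableEq ι] [DecidableEq μ] [DecidableEq ρ₂] in
/-- [folklore] **A NON-ZERO SCALAR ON THE FORM BLOCKS DROPS OUT OF THE GRADED BORDERED 2-JET**: for `c ≠ 0` and ANY `H₀ H₁ H₂`, `Q₀ Q₁ Q₂`
(no symmetry, no invertibility asked),
`secondVar (kkt (c•H₀) Q₀) ([[c•H₁, −Q₁ᵀ],[Q₁, 0]]) (kkt (c•H₂) Q₂) = secondVar (kkt H₀ Q₀) ([[H₁, −Q₁ᵀ],[Q₁, 0]]) (kkt H₂ Q₂)` —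
the graded twin of `CoarseJetUnit.secondVar_kkt_smul_form` (OWNER d1-p3 g19's W-FP-19-5 statement). -/
theorem secondVar_kkt_smul_form_graded {c : ℝ} (hc : c ≠ 0) (H₀ H₁ H₂ : Matrix ν ν ℝ) (Q₀ Q₁ Q₂ : Matrix κ ν ℝ) :
    secondVar (kkt (c • H₀) Q₀) (fromBlocks (c • H₁) (-Q₁ᵀ) Q₁ 0) (kkt (c • H₂) Q₂)
      = secondVar (kkt H₀ Q₀) (fromBlocks H₁ (-Q₁ᵀ) Q₁ 0) (kkt H₂ Q₂) := by
  have hL : IsUnit (fromBlocks (c • (1 : Matrix ν ν ℝ)) 0 0 (1 : Matrix κ κ ℝ)).det := by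
    rw [det_fromBlocks_zero₂₁, det_one, mul_one, det_smul, det_one, mul_one]
    exact isUnit_iff_ne_zero.2 (pow_ne_zero _ hc)
  have hR : IsUnit (fromBlocks (1 : Matrix ν ν ℝ) 0 0 (c⁻¹ • (1 : Matrix κ κ ℝ))).det := by
    rw [det_fromBlocks_zero₂₁, det_one, one_mul, det_smul, det_one, mul_one]
    exact isUnit_iff_ne_zero.2 (pow_ne_zero _ (inv_ne_zero hc))
  rw [kkt_smul_form_eq_conj hc H₀, signTwist_smul_form_eq_conj hc H₁, kkt_smul_form_eq_conj hc H₂,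
    secondVar_mul_right _ _ _ _ hR, secondVar_mul_left _ _ _ _ hL]

/-! ## §3 The GRADED coarse term of the one-shot-sliced composite step law, in its exact shape -/

omit [Fintype ι] [Fintype ν] [DecidableEq ι] [DecidableEq ν] in
/-- [folklore] **THE GRADED COARSE SLICED 2-JET UNDER THE IDENTIFICATIONS `hId₀ hId₁ hId₂`** (the exact shape of the coarse term of
`NestedStepLawOneShotJetsGraded.secondVar_oneShot_nestedStepLaw_jets_graded`: odd jet (−)-placed): if `Eᵢ = c • H'ᵢ` (`i = 0, 1, 2`) for one
non-zero scalar `c`, then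
`secondVar (kkt E₀ [Q₂₀;τ₂]) ([[E₁, −[Q₂₁;0]ᵀ],[[Q₂₁;0], 0]]) (kkt E₂ [Q₂₂;0]) = secondVar (kkt H'₀ [Q₂₀;τ₂]) ([[H'₁, −[Q₂₁;0]ᵀ],[[Q₂₁;0], 0]]) (kkt H'₂ [Q₂₂;0])`. -/
theorem secondVar_coarse_of_hId_graded {c : ℝ} (hc : c ≠ 0) {E₀ E₁ E₂ H'₀ H'₁ H'₂ : Matrix μ μ ℝ}
    (Q₂₀ Q₂₁ Q₂₂ : Matrix κ μ ℝ) (τ₂ : Matrix ρ₂ μ ℝ)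
    (hId₀ : E₀ = c • H'₀) (hId₁ : E₁ = c • H'₁) (hId₂ : E₂ = c • H'₂) :
    secondVar (kkt E₀ (fromRows Q₂₀ τ₂))
        (fromBlocks E₁ (-(fromRows Q₂₁ (0 : Matrix ρ₂ μ ℝ))ᵀ) (fromRows Q₂₁ (0 : Matrix ρ₂ μ ℝ)) 0)
        (kkt E₂ (fromRows Q₂₂ (0 : Matrix ρ₂ μ ℝ)))
      = secondVar (kkt H'₀ (fromRows Q₂₀ τ₂))
          (fromBlocks H'₁ (-(fromRows Q₂₁ (0 : Matrix ρ₂ μ ℝ))ᵀ) (fromRows Q₂₁ (0 : Matrix ρ₂ μ ℝ)) 0)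
          (kkt H'₂ (fromRows Q₂₂ (0 : Matrix ρ₂ μ ℝ))) := by
  rw [hId₀, hId₁, hId₂]
  exact secondVar_kkt_smul_form_graded hc _ _ _ _ _ _

end Generic

/-! ## §4 At the record: the torus call's GRADED coarse term is the level-`(j+1)` graded sliced one-step 2-jet, given the dictionary at orders 1–2 -/

section Record

variable {d : ℕ} {Lc : ℕ} [NeZero Lc] {r : Fin (d + 1) → ℕ} (M' : Fin (d + 1) → ℕ) [∀ i, NeZero (M' i)]

set_option synthInstance.maxSize 1024 in
/-- **[folklore] THE TORUS CALL's GRADED COARSE TERM READ ONE LEVEL UP** — `CoarseJetUnit.torus_coarse_secondVar_of_hId` with the middle jets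
(−)-PLACED: same index types of record, same binders (`hr j r′ cp hcp hfμ hcoarse`, the call's `hH₀ hQ₁₀ hτ₁`, `hS`, free coarse border ∕ slice
`Q₂₀ Q₂₁ Q₂₂ τ₂`, DISPLAYED `hId₁ : E₁ = (wVH d Lc (j+1))⁻¹ • H'₁`, `hId₂ : E₂ = (wVH d Lc (j+1))⁻¹ • H'₂`), same `H'₀ := (perF M′ (bhKStepAt d
(toSite r′) Lc (j+1)))∘(fields, fields)`; order 0 by `RelInvPeriodisedEffFormCoarse.hId_order_zero_record`, the unit removed by
`secondVar_coarse_of_hId_graded`. -/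
theorem torus_coarse_secondVar_of_hId_graded (hr : r ∈ box (d + 1) Lc) (j : ℕ) (r' : Fin (d + 1) → ℕ)
    (cp : ↥(pbox M') → ↥(pbox (fine Lc M'))) (hcp : ∀ p : ↥(pbox M'), (cp p : Site (d + 1)) = (Lc : ℤ) • (p : Site (d + 1)))
    (hfμ : Function.Injective (fun a : ↥(pbox M') × Fin (d + 1) => ((cp a.1, Sum.inr a.2) : Idx (fine Lc M') (Fib d))))
    (hcoarse : ∀ (s : ↥(pbox (fine Lc M'))) (m : Fin (d + 1)),
      ((s, Sum.inr m) : Idx (fine Lc M') (Fib d)) ∈ Set.range (fun a : ↥(pbox M') × Fin (d + 1) => ((cp a.1, Sum.inr a.2) : Idx (fine Lc M') (Fib d)))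
        ↔ Torus.proj Lc (s : Site (d + 1)) = 0)
    -- the fine objects of the torus call, by defining equations (p313662 verbatim)
    {H₀ : Matrix (↥(pbox (fine Lc M')) × Fin (d + 1)) (↥(pbox (fine Lc M')) × Fin (d + 1)) ℝ}
    {Q₁₀ : Matrix (↥(pbox M') × Fin (d + 1)) (↥(pbox (fine Lc M')) × Fin (d + 1)) ℝ}
    {τ₁ : Matrix (Res (toSite r) Lc (fine Lc M')) (↥(pbox (fine Lc M')) × Fin (d + 1)) ℝ}
    (hH₀ : H₀ = (perF (fine Lc M') (bhKStepAt d (toSite r) Lc j)).submatrix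
        (fun b : ↥(pbox (fine Lc M')) × Fin (d + 1) => ((b.1, Sum.inl b.2) : Idx (fine Lc M') (Fib d)))
        (fun b : ↥(pbox (fine Lc M')) × Fin (d + 1) => ((b.1, Sum.inl b.2) : Idx (fine Lc M') (Fib d))))
    (hQ₁₀ : Q₁₀ = (perF (fine Lc M') (bhKStepAt d (toSite r) Lc j)).submatrix
        (fun a : ↥(pbox M') × Fin (d + 1) => ((cp a.1, Sum.inr a.2) : Idx (fine Lc M') (Fib d)))
        (fun b : ↥(pbox (fine Lc M')) × Fin (d + 1) => ((b.1, Sum.inl b.2) : Idx (fine Lc M') (Fib d))))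
    (hτ₁ : τ₁ = (combRowsT (toSite r) Lc (fine Lc M')).submatrix id
        (fun b : ↥(pbox (fine Lc M')) × Fin (d + 1) => ((b.1, Sum.inl b.2) : Idx (fine Lc M') (Fib d))))
    {S : Matrix ((↥(pbox M') × Fin (d + 1)) ⊕ Res (toSite r) Lc (fine Lc M')) ((↥(pbox M') × Fin (d + 1)) ⊕ Res (toSite r) Lc (fine Lc M')) ℝ}
    (hS : effForm H₀ (fromRows Q₁₀ τ₁) = S)
    -- the coarse border and slice of the torus call (free here)
    {κ ρ₂ : Type*} [Fintype κ] [DecidableEq κ] [Fintype ρ₂] [DecidableEq ρ₂]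
    (Q₂₀ Q₂₁ Q₂₂ : Matrix κ (↥(pbox M') × Fin (d + 1)) ℝ) (τ₂ : Matrix ρ₂ (↥(pbox M') × Fin (d + 1)) ℝ)
    -- the dictionary at orders 1–2, DISPLAYED
    {E₁ E₂ H'₁ H'₂ : Matrix (↥(pbox M') × Fin (d + 1)) (↥(pbox M') × Fin (d + 1)) ℝ}
    (hId₁ : E₁ = (wVH d Lc (j + 1))⁻¹ • H'₁) (hId₂ : E₂ = (wVH d Lc (j + 1))⁻¹ • H'₂) :
    secondVar (kkt S.toBlocks₁₁ (fromRows Q₂₀ τ₂))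
        (fromBlocks E₁ (-(fromRows Q₂₁ (0 : Matrix ρ₂ (↥(pbox M') × Fin (d + 1)) ℝ))ᵀ)
          (fromRows Q₂₁ (0 : Matrix ρ₂ (↥(pbox M') × Fin (d + 1)) ℝ)) 0)
        (kkt E₂ (fromRows Q₂₂ (0 : Matrix ρ₂ (↥(pbox M') × Fin (d + 1)) ℝ)))
      = secondVar
          (kkt ((perF M' (bhKStepAt d (toSite r') Lc (j + 1))).submatrix
              (fun b : ↥(pbox M') × Fin (d + 1) => ((b.1, Sum.inl b.2) : Idx M' (Fib d)))
              (fun b : ↥(pbox M') × Fin (d + 1) => ((b.1, Sum.inl b.2) : Idx M' (Fib d))))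
            (fromRows Q₂₀ τ₂))
          (fromBlocks H'₁ (-(fromRows Q₂₁ (0 : Matrix ρ₂ (↥(pbox M') × Fin (d + 1)) ℝ))ᵀ)
            (fromRows Q₂₁ (0 : Matrix ρ₂ (↥(pbox M') × Fin (d + 1)) ℝ)) 0)
          (kkt H'₂ (fromRows Q₂₂ (0 : Matrix ρ₂ (↥(pbox M') × Fin (d + 1)) ℝ))) := by
  have hw : (wVH d Lc (j + 1))⁻¹ ≠ 0 := inv_ne_zero (wVH_pos (d := d) (Nat.pos_of_ne_zero (NeZero.ne Lc)) (j + 1)).ne'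
  have hId₀ := hId_order_zero_record M' hr j r' cp hcp hfμ hcoarse
  rw [← hS, hH₀, hQ₁₀, hτ₁]
  exact secondVar_coarse_of_hId_graded hw Q₂₀ Q₂₁ Q₂₂ τ₂ hId₀ hId₁ hId₂

end Record

end Summit.QuantumFields.BalabanUV.Beta.FP.CoarseJetUnitGraded

end
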